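import Mathlib
import Summits.Ventures.PercRepro2.Defs
import Summits.Ventures.PercRepro2.Graph
import Summits.Ventures.PercRepro2.Events
import Summits.Ventures.PercRepro2.BHKEvents
import Summits.Ventures.PercRepro2.BHKAvoid
import Summits.Ventures.PercRepro2.OrderPreservation
import Summits.Ventures.PercRepro2.HCov
import Summits.Ventures.PercRepro2.PendantRoot
import Summits.Ventures.PercRepro2.DiagBA3
import Summits.Ventures.PercRepro2.A3Inactive

/-!
# The `(α, β)` form of the covariance form: `β ≥ 0`
(blind cell PercRepro2, mine-2 g15; MINE2-A3FIRST.md §4, «the (α, β) form»)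

Factoring the second copy out of `Gc = P(Q)·[D·EQbo + D_o·EQb3 − D·EQb3o] + gap·[D·EQo + D_o·EQ3 − D·EQ3o]
+ P(Q)·[D_o·PDb − D·PDbo]` gives `Gc = D·α + D_o·β` with the two copy-(1,3) quadratic forms

  `α = P(Q)·(EQbo − EQb3o − PDbo) + gap·(EQo − EQ3o)`,   `β = P(Q)·(EQb3 + PDb) + gap·EQ3`

(`Gc_eq_alpha_beta`, by `ring`). **`β ≥ 0` is a theorem** (`beta_nonneg`): writing `T′ = Q ∩ {a₁ ↔ a₃}`,
`T = Q ∩ {a₂ ↔ a₃}` and `gap = P(Q, bH) − P(Q, bL)`,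

  `β = [P(Q) P(Q,bL,3L) − P(Q,bL) P(Q,3L)] + [P(Q) P(Q,bH,3H) − P(Q,bH) P(Q,3H)]
       + [P(Q,bL) P(Q,3H) − P(Q) P(Q,bL,3H)] + [P(Q,bH) P(Q,3L) − P(Q) P(Q,bH,3L)] + P(Q)·P(PD, b ∈ U)`,

the first two brackets are `≥ 0` by van den Berg–Häggström–Kahn's same-cluster positive association
given `a₁ ↮ a₂` (`bhk_same_cluster_events`, BHK06 Thm 1.2/1.3, `s = a₁, t = a₂` and the mirror), the
next two by the cross-cluster inequality (`bhk_cross_cluster_avoid`, Thm 1.4), and the last is a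
product of probabilities. Consequence: `Gc ≥ D·α`, and (HCOV) reads `α + γ·β ≥ 0` at
`γ = P(o ∈ U | PD)` — the census of MINE2-A3FIRST §4 shows this holds with copy 2 restricted to each
`a₃`-world separately, the PD world (with the smallest `γ`) being the binding one.
-/

namespace Summit.Ventures.PercRepro2
namespace AlphaBeta

open CovForm DiagBA3 PendantRoot UnionCluster

variable {V : Type*} {E : Type*} [Fintype E] [DecidableEq E] [DecidableEq V]
  {R : Type*} [Field R] [LinearOrder R] [IsStrictOrderedRing R]

/-- `α = P(Q)·(EQbo − EQb3o − PDbo) + gap·(EQo − EQ3o)`. -/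
noncomputable def alpha (p : E → R) (ends : E → Sym2 V) (o a₁ a₂ a₃ b : V) : R :=
  prob p (avoidAll ends a₂ {a₁}) *
      (EQbo p ends o a₁ a₂ b - EQb3o p ends o a₁ a₂ a₃ b - PDbo p ends o a₁ a₂ a₃ b) +
    gap p ends a₁ a₂ b * (EQo p ends o a₁ a₂ - EQ3o p ends o a₁ a₂ a₃)

/-- `β = P(Q)·(EQb3 + PDb) + gap·EQ3`. -/
noncomputable def beta (p : E → R) (ends : E → Sym2 V) (a₁ a₂ a₃ b : V) : R :=
  prob p (avoidAll ends a₂ {a₁}) * (EQb3 p ends a₁ a₂ a₃ b + PDb p ends a₁ a₂ a₃ b) +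
    gap p ends a₁ a₂ b * EQ3 p ends a₁ a₂ a₃

omit [DecidableEq V] [LinearOrder R] [IsStrictOrderedRing R] in
/-- **`Gc = D·α + D_o·β`** (copy 2 factored out). -/
theorem Gc_eq_alpha_beta (p : E → R) (ends : E → Sym2 V) (o a₁ a₂ a₃ b : V) :
    Gc p ends o a₁ a₂ a₃ b =
      prob p (PDEvent ends a₁ a₂ a₃) * alpha p ends o a₁ a₂ a₃ b +
        Do p ends o a₁ a₂ a₃ * beta p ends a₁ a₂ a₃ b := by
  unfold Gc DEF alpha beta
  ring

section Signs

variable [Fintype V]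

/-- Same-cluster positive association given `a₁ ↮ a₂`: `P(Q,bL)·P(Q,3L) ≤ P(Q,bL,3L)·P(Q)`
(`bhk_same_cluster_events`, `s = a₁`, `t = a₂`, up-sets `{b ∈ ·}`, `{a₃ ∈ ·}`). -/
theorem bL_mul_3L_le (p : E → R) (hp : IsProbVec p) (ends : E → Sym2 V) (a₁ a₂ a₃ b : V) :
    prob p (avoidAll ends a₂ {a₁} ∩ connEvent ends a₁ b) *
        prob p (avoidAll ends a₂ {a₁} ∩ connEvent ends a₁ a₃) ≤
      prob p (avoidAll ends a₂ {a₁} ∩ (connEvent ends a₁ a₃ ∩ connEvent ends a₁ b)) *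
        prob p (avoidAll ends a₂ {a₁}) := by
  have h := bhk_same_cluster_events p hp ends a₁ a₂ (isUpperSet_mem_setOf b) (isUpperSet_mem_setOf a₃)
  rw [← connEvent_eq_clusterInEvent ends a₁ b, ← connEvent_eq_clusterInEvent ends a₁ a₃,
    ← avoidAll_eq_compl ends a₁ a₂] at h
  have e1 : connEvent ends a₁ b ∩ avoidAll ends a₂ {a₁} = avoidAll ends a₂ {a₁} ∩ connEvent ends a₁ b :=
    Set.inter_comm _ _
  have e2 : connEvent ends a₁ a₃ ∩ avoidAll ends a₂ {a₁} =
      avoidAll ends a₂ {a₁} ∩ connEvent ends a₁ a₃ := Set.inter_comm _ _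
  have e3 : connEvent ends a₁ b ∩ connEvent ends a₁ a₃ ∩ avoidAll ends a₂ {a₁} =
      avoidAll ends a₂ {a₁} ∩ (connEvent ends a₁ a₃ ∩ connEvent ends a₁ b) := by
    ext; simp only [Set.mem_inter_iff]; tauto
  rw [e1, e2, e3] at h
  exact h

/-- The mirror: `P(Q,bH)·P(Q,3H) ≤ P(Q,bH,3H)·P(Q)` (`s = a₂`, `t = a₁`). -/
theorem bH_mul_3H_le (p : E → R) (hp : IsProbVec p) (ends : E → Sym2 V) (a₁ a₂ a₃ b : V) :
    prob p (avoidAll ends a₂ {a₁} ∩ connEvent ends a₂ b) *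
        prob p (avoidAll ends a₂ {a₁} ∩ connEvent ends a₂ a₃) ≤
      prob p (avoidAll ends a₂ {a₁} ∩ (connEvent ends a₂ a₃ ∩ connEvent ends a₂ b)) *
        prob p (avoidAll ends a₂ {a₁}) := by
  have h := bhk_same_cluster_events p hp ends a₂ a₁ (isUpperSet_mem_setOf b) (isUpperSet_mem_setOf a₃)
  rw [← connEvent_eq_clusterInEvent ends a₂ b, ← connEvent_eq_clusterInEvent ends a₂ a₃,
    ← avoidAll_eq_compl ends a₂ a₁, A3Inactive.avoidAll_singleton_comm ends a₁ a₂] at h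
  have e1 : connEvent ends a₂ b ∩ avoidAll ends a₂ {a₁} = avoidAll ends a₂ {a₁} ∩ connEvent ends a₂ b :=
    Set.inter_comm _ _
  have e2 : connEvent ends a₂ a₃ ∩ avoidAll ends a₂ {a₁} =
      avoidAll ends a₂ {a₁} ∩ connEvent ends a₂ a₃ := Set.inter_comm _ _
  have e3 : connEvent ends a₂ b ∩ connEvent ends a₂ a₃ ∩ avoidAll ends a₂ {a₁} =
      avoidAll ends a₂ {a₁} ∩ (connEvent ends a₂ a₃ ∩ connEvent ends a₂ b) := by
    ext; simp only [Set.mem_inter_iff]; tauto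
  rw [e1, e2, e3] at h
  exact h

/-- Cross-cluster: `P(Q)·P(Q,bL,3H) ≤ P(Q,bL)·P(Q,3H)` (`bhk_cross_cluster_avoid`, `s = a₁`,
`X = {a₂}`, up-sets `{b ∈ ·}` for `C(a₁)`, `{a₃ ∈ ·}` for `C(a₂)`). -/
theorem bL3H_mul_Q_le (p : E → R) (hp : IsProbVec p) (ends : E → Sym2 V) (a₁ a₂ a₃ b : V) :
    prob p (avoidAll ends a₂ {a₁}) *
        prob p (avoidAll ends a₂ {a₁} ∩ (connEvent ends a₂ a₃ ∩ connEvent ends a₁ b)) ≤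
      prob p (avoidAll ends a₂ {a₁} ∩ connEvent ends a₁ b) *
        prob p (avoidAll ends a₂ {a₁} ∩ connEvent ends a₂ a₃) := by
  have h := bhk_cross_cluster_avoid p hp ends a₁ a₂ (X := {a₂}) (Finset.mem_singleton_self a₂)
    (isUpperSet_mem_setOf b) (isUpperSet_mem_setOf a₃)
  rw [← connEvent_eq_clusterInEvent ends a₁ b, ← connEvent_eq_clusterInEvent ends a₂ a₃,
    A3Inactive.avoidAll_singleton_comm ends a₁ a₂] at h
  have e1 : connEvent ends a₁ b ∩ connEvent ends a₂ a₃ ∩ avoidAll ends a₂ {a₁} =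
      avoidAll ends a₂ {a₁} ∩ (connEvent ends a₂ a₃ ∩ connEvent ends a₁ b) := by
    ext; simp only [Set.mem_inter_iff]; tauto
  have e2 : connEvent ends a₁ b ∩ avoidAll ends a₂ {a₁} =
      avoidAll ends a₂ {a₁} ∩ connEvent ends a₁ b := Set.inter_comm _ _
  have e3 : connEvent ends a₂ a₃ ∩ avoidAll ends a₂ {a₁} =
      avoidAll ends a₂ {a₁} ∩ connEvent ends a₂ a₃ := Set.inter_comm _ _
  rw [e1, e2, e3] at h
  linarith [h]

/-- The mirror cross-cluster inequality: `P(Q)·P(Q,bH,3L) ≤ P(Q,bH)·P(Q,3L)`. -/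
theorem bH3L_mul_Q_le (p : E → R) (hp : IsProbVec p) (ends : E → Sym2 V) (a₁ a₂ a₃ b : V) :
    prob p (avoidAll ends a₂ {a₁}) *
        prob p (avoidAll ends a₂ {a₁} ∩ (connEvent ends a₁ a₃ ∩ connEvent ends a₂ b)) ≤
      prob p (avoidAll ends a₂ {a₁} ∩ connEvent ends a₂ b) *
        prob p (avoidAll ends a₂ {a₁} ∩ connEvent ends a₁ a₃) := by
  have h := bhk_cross_cluster_avoid p hp ends a₂ a₁ (X := {a₁}) (Finset.mem_singleton_self a₁)
    (isUpperSet_mem_setOf b) (isUpperSet_mem_setOf a₃)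
  rw [← connEvent_eq_clusterInEvent ends a₂ b, ← connEvent_eq_clusterInEvent ends a₁ a₃] at h
  have e1 : connEvent ends a₂ b ∩ connEvent ends a₁ a₃ ∩ avoidAll ends a₂ {a₁} =
      avoidAll ends a₂ {a₁} ∩ (connEvent ends a₁ a₃ ∩ connEvent ends a₂ b) := by
    ext; simp only [Set.mem_inter_iff]; tauto
  have e2 : connEvent ends a₂ b ∩ avoidAll ends a₂ {a₁} =
      avoidAll ends a₂ {a₁} ∩ connEvent ends a₂ b := Set.inter_comm _ _
  have e3 : connEvent ends a₁ a₃ ∩ avoidAll ends a₂ {a₁} =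
      avoidAll ends a₂ {a₁} ∩ connEvent ends a₁ a₃ := Set.inter_comm _ _
  rw [e1, e2, e3] at h
  linarith [h]

/-- **`β ≥ 0`**: the `D_o`-coefficient of the covariance form is nonnegative (two same-cluster and
two cross-cluster BHK instances plus a product of probabilities). -/
theorem beta_nonneg (p : E → R) (hp : IsProbVec p) (ends : E → Sym2 V) (a₁ a₂ a₃ b : V) :
    0 ≤ beta p ends a₁ a₂ a₃ b := by
  unfold beta EQb3 EQ3 PDb
  rw [gap_eq_Q]
  simp only [← Q_inter_conn13 ends a₁ a₂ a₃, ← Q_inter_conn23 ends a₁ a₂ a₃, Set.inter_assoc]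
  have h1 := bL_mul_3L_le p hp ends a₁ a₂ a₃ b
  have h2 := bH_mul_3H_le p hp ends a₁ a₂ a₃ b
  have h3 := bL3H_mul_Q_le p hp ends a₁ a₂ a₃ b
  have h4 := bH3L_mul_Q_le p hp ends a₁ a₂ a₃ b
  have hQ := prob_nonneg hp (avoidAll ends a₂ {a₁})
  have hPD1 := prob_nonneg hp (PDEvent ends a₁ a₂ a₃ ∩ connEvent ends a₁ b)
  have hPD2 := prob_nonneg hp (PDEvent ends a₁ a₂ a₃ ∩ connEvent ends a₂ b)
  nlinarith [h1, h2, h3, h4, mul_nonneg hQ hPD1, mul_nonneg hQ hPD2]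

/-- **`Gc ≥ D·α`** — consequence of `β ≥ 0`. -/
theorem Gc_ge_D_mul_alpha (p : E → R) (hp : IsProbVec p) (ends : E → Sym2 V) (o a₁ a₂ a₃ b : V) :
    prob p (PDEvent ends a₁ a₂ a₃) * alpha p ends o a₁ a₂ a₃ b ≤ Gc p ends o a₁ a₂ a₃ b := by
  rw [Gc_eq_alpha_beta]
  have hDo : 0 ≤ Do p ends o a₁ a₂ a₃ := by
    unfold Do
    have := prob_nonneg hp (PDEvent ends a₁ a₂ a₃ ∩ connEvent ends a₁ o)
    have := prob_nonneg hp (PDEvent ends a₁ a₂ a₃ ∩ connEvent ends a₂ o)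
    linarith
  have := mul_nonneg hDo (beta_nonneg p hp ends a₁ a₂ a₃ b)
  linarith

end Signs

end AlphaBeta
end Summit.Ventures.PercRepro2
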